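import Mathlib.MeasureTheory.Integral.IntervalIntegral.FundThmCalculus
import Summits.NavierStokesRegularity.OSWSelfSimilar.SheetNSLineTorusCascadeWiener
import Summits.NavierStokesRegularity.OSWSelfSimilar.SheetNSLineTorusCascadeStationaryPole
import HarnessLib

/-!
# Viscous CLM on the torus (`a = 0`, `σ = 2`): the cascade HAS a global solution for every datum, and only one —
# the object all comparison theorems of the family quantify over exists (explicit strong recursion over the triangular system)

HONEST FRAMING (cell ns-blowup GROUP B «PROFILE SEARCH», zone Z3, row Z3-U addendum A-F2 of `HOME/profile/z3/CENSUS-Z3.md`,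
pen gap (g2); human rulings D-0035/D-0074; profile-lead RULING (hh)(1), 2026-08-27): **1-D MODEL (viscous Constantin–Lax–Majda
equation `ω_t = ω Hω + ν ω_xx` on `𝕋 = ℝ/2πℤ`); ODE calculus on Fourier-coefficient families, kernel-checked; not Euler, not
Navier–Stokes; «violates: none — MODEL».**

OBJECT. Every theorem of the family `SheetNSLineTorusCascade*` (pole lower bound and blow-up for `c ≥ 48ν`, `σ = 1` and
stationary-pole super-solutions, the Wiener/Riccati threshold `2ν`, the tail and moving-pole inductions, the time shift) is
stated for a GIVEN coefficient family `e : ℕ → ℝ → ℝ` carrying `IsSineCascade ν c e` / `IsNonnegCascade ν e` — continuous on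
`[0, ∞)`, solving the cascade `ċ_k = ½ Σ_{i+j=k} c_i c_j − ν k² c_k` for `t > 0`, with the datum. No file so far CONSTRUCTS such
a family; the census sentence «a GLOBAL solution of the nonnegative cascade exists and is the object the Riccati / moving-pole
comparison theorems quantify over» was pen. HERE it is kernel, with NO size, sign or analytic-norm hypothesis, because the
cascade is LOWER-TRIANGULAR: with `c_0 ≡ 0` the convolution driving mode `k` only involves the modes `1, …, k − 1`, so mode `k`
solves a LINEAR equation forced by the lower modes and is given by Duhamel's formula

  `c_k(t) = e^{−νk²t} ( a_k + ½ ∫₀ᵗ e^{νk²s} Σ_{i+j=k, i,j<k} c_i(s) c_j(s) ds )`,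

defined for ALL `t ∈ ℝ` by strong recursion on `k` (`cascadeSolution ν a`, `cascadeSolution_eq`). Contents:

* `cascadeSolution ν a` — the explicit family; `cascadeSolution_mode_zero` (`a 0 = 0 ⇒ c_0 ≡ 0`), `cascadeSolution_init`
  (`c_k(0) = a_k`), `continuous_cascadeSolution`, `hasDerivAt_cascadeSolution` (the cascade ODE at EVERY `t ∈ ℝ`);
* `isNonnegCascade_cascadeSolution`, **`exists_isNonnegCascade`** — for every datum `a` with `a 0 = 0`, `a k ≥ 0` there is a
  GLOBAL nonnegative cascade with `e k 0 = a k`; `isSineCascade_cascadeSolution`, **`exists_isSineCascade`** (every `ν`, `c`);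
* **uniqueness** `eq_of_datum_eq` (sign-free: two coefficient families continuous on `[0, ∞)` solving the cascade for `t > 0`
  with `c_0 ≡ 0` and equal data agree on `[0, ∞)`; strong induction, `e^{νk²t}(c_k − c′_k)` has zero derivative),
  `IsNonnegCascade.eq_of_datum_eq`, `IsSineCascade.unique`, and `IsNonnegCascade.eq_cascadeSolution` /
  `IsSineCascade.eq_cascadeSolution` — **every cascade of the family IS the explicit solution from its own datum**;
* the census packaging (the family's conditional theorems made unconditional): `exists_global_of_wiener` (`Σ_{k≤K} a_k ≤ W < 2ν`,
  `a_1 > 0` ⇒ the solution obeys `Σ_{k≤K} c_k(t) ≤ (2νW/(2ν − W)) e^{−νt}` for all `K`, `t ≥ 0` — a GLOBAL family with uniformly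
  bounded, decaying Wiener (`B₀`) partial sums), `exists_global_sine_of_lt_twelve` (`0 ≤ c < 12ν`: stationary-pole bound for all
  `t ≥ 0`), `exists_sine_unbounded_of_le` (`48ν ≤ c`: the solution's coefficients are unbounded at `t = log 2/ν`).

READING. After this file the only pen/print part of the A-F2 sentence's clause (g2) is the PDE ↔ cascade dictionary (a
`B₀`-valued solution of `z_t = ½ z² + ν z_xx` has Fourier coefficients obeying the cascade and conversely a summable cascade sums to
one; Ambrose–Lushnikov–Siegel–Silantyev 2024 §3) — by design the family has no PDE object. bears_on: LADDER-NS N5 / zone Z3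
(row Z3-U) → N1 linear core. WHAT THIS IS NOT: not NS; no PDE object; nothing about the threshold value.
-/

noncomputable section

namespace Summit.NavierStokesRegularity.OSWSelfSimilar
namespace SheetNSLineTorusCascade

open Finset Real Set MeasureTheory intervalIntegral

/-! ### The explicit solution by strong recursion -/

/-- One step of the recursion: mode `k` from the modes `< k` by Duhamel's formula for the linear equation
`ċ_k = ½ Σ_{i+j=k, i,j<k} c_i c_j − ν k² c_k`, `c_k(0) = a_k` (the pairs `(0, k)`, `(k, 0)` are dropped — they contribute
nothing once `c_0 ≡ 0`). [new here — MODEL] -/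
def cascadeStep (ν : ℝ) (a : ℕ → ℝ) (k : ℕ) (lower : (m : ℕ) → m < k → ℝ → ℝ) : ℝ → ℝ :=
  fun t => exp (-(ν * (k : ℝ) ^ 2 * t)) *
    (a k + 1 / 2 * ∫ s in (0 : ℝ)..t, exp (ν * (k : ℝ) ^ 2 * s) *
      ∑ p ∈ antidiagonal k, (if h : p.1 < k ∧ p.2 < k then lower p.1 h.1 s * lower p.2 h.2 s else 0))

/-- **The explicit global solution of the cascade from the datum `a`** (`a k` = prescribed `c_k(0)`), by strong recursion on
the mode number: `cascadeSolution ν a k t = e^{−νk²t}(a_k + ½ ∫₀ᵗ e^{νk²s} Σ_{i+j=k, i,j<k} c_i c_j ds)`, defined for every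
real `t`. [new here — MODEL] -/
def cascadeSolution (ν : ℝ) (a : ℕ → ℝ) : ℕ → ℝ → ℝ :=
  Nat.strongRec (cascadeStep ν a)

variable {ν c : ℝ} {a : ℕ → ℝ}

/-- The truncated convolution driving mode `k` in the recursion. -/
def truncConv (ν : ℝ) (a : ℕ → ℝ) (k : ℕ) (s : ℝ) : ℝ :=
  ∑ p ∈ antidiagonal k, (if p.1 < k ∧ p.2 < k then cascadeSolution ν a p.1 s * cascadeSolution ν a p.2 s else 0)

/-- **Duhamel unfolding of the recursion.** [new here — MODEL] -/
theorem cascadeSolution_eq (k : ℕ) (t : ℝ) :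
    cascadeSolution ν a k t =
      exp (-(ν * (k : ℝ) ^ 2 * t)) * (a k + 1 / 2 * ∫ s in (0 : ℝ)..t, exp (ν * (k : ℝ) ^ 2 * s) * truncConv ν a k s) := by
  have h := congrFun (Nat.strongRec_eq (cascadeStep ν a) k) t
  rw [cascadeSolution, h]
  simp only [cascadeStep, truncConv, dite_eq_ite]
  rfl

/-- **The datum is attained:** `c_k(0) = a_k`. [new here — MODEL] -/
theorem cascadeSolution_init (k : ℕ) : cascadeSolution ν a k 0 = a k := by
  rw [cascadeSolution_eq]
  simp

/-- **Mode `0` vanishes identically** when `a 0 = 0` (mean-zero class). [new here — MODEL] -/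
theorem cascadeSolution_mode_zero (h0 : a 0 = 0) (t : ℝ) : cascadeSolution ν a 0 t = 0 := by
  rw [cascadeSolution_eq]
  have hsum : ∀ s : ℝ, truncConv ν a 0 s = 0 := fun s => by simp [truncConv]
  simp [hsum, h0]

/-- Once mode `0` vanishes, the truncated convolution is the full one `Σ_{i+j=k} c_i c_j`. -/
theorem truncConv_eq (h0 : a 0 = 0) (k : ℕ) (s : ℝ) :
    truncConv ν a k s = ∑ p ∈ antidiagonal k, cascadeSolution ν a p.1 s * cascadeSolution ν a p.2 s := by
  refine sum_congr rfl fun p hp => ?_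
  have hsum : p.1 + p.2 = k := mem_antidiagonal.mp hp
  by_cases h : p.1 < k ∧ p.2 < k
  · rw [if_pos h]
  · rw [if_neg h]
    rcases Nat.eq_zero_or_pos p.1 with h1 | h1
    · rw [h1, cascadeSolution_mode_zero h0, zero_mul]
    rcases Nat.eq_zero_or_pos p.2 with h2 | h2
    · rw [h2, cascadeSolution_mode_zero h0, mul_zero]
    exact absurd ⟨by omega, by omega⟩ h

/-- **Every mode is continuous on `ℝ`** (strong induction: the integrand of the recursion is continuous). [new here — MODEL] -/
theorem continuous_cascadeSolution (k : ℕ) : Continuous (cascadeSolution ν a k) := by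
  induction k using Nat.strong_induction_on with
  | _ k ih =>
    have hF : Continuous (fun s => exp (ν * (k : ℝ) ^ 2 * s) * truncConv ν a k s) := by
      refine (continuous_exp.comp (continuous_const.mul continuous_id)).mul ?_
      refine continuous_finsetSum _ fun p _ => ?_
      split_ifs with h
      · exact (ih p.1 h.1).mul (ih p.2 h.2)
      · exact continuous_const
    have hI : Continuous (fun t => ∫ s in (0 : ℝ)..t, exp (ν * (k : ℝ) ^ 2 * s) * truncConv ν a k s) :=
      continuous_iff_continuousAt.2 fun t => (hF.integral_hasStrictDerivAt 0 t).hasDerivAt.continuousAt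
    have hfun : cascadeSolution ν a k = fun t =>
        exp (-(ν * (k : ℝ) ^ 2 * t)) * (a k + 1 / 2 * ∫ s in (0 : ℝ)..t, exp (ν * (k : ℝ) ^ 2 * s) * truncConv ν a k s) :=
      funext (cascadeSolution_eq k)
    rw [hfun]
    exact (continuous_exp.comp (continuous_const.mul continuous_id).neg).mul (continuous_const.add (continuous_const.mul hI))

/-- Continuity of the truncated convolution. -/
theorem continuous_truncConv (k : ℕ) : Continuous (truncConv ν a k) := by
  refine continuous_finsetSum _ fun p _ => ?_
  split_ifs with h
  · exact (continuous_cascadeSolution p.1).mul (continuous_cascadeSolution p.2)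
  · exact continuous_const

/-- **The cascade ODE holds at every real time:** `ċ_k(t) = ½ Σ_{i+j=k} c_i(t) c_j(t) − ν k² c_k(t)` (product rule and the
fundamental theorem of calculus on the Duhamel formula; needs `a 0 = 0`). [new here — MODEL] -/
theorem hasDerivAt_cascadeSolution (h0 : a 0 = 0) (k : ℕ) (t : ℝ) :
    HasDerivAt (cascadeSolution ν a k)
      ((1 / 2) * (∑ p ∈ antidiagonal k, cascadeSolution ν a p.1 t * cascadeSolution ν a p.2 t)
        - ν * (k : ℝ) ^ 2 * cascadeSolution ν a k t) t := by
  have hF : Continuous (fun s => exp (ν * (k : ℝ) ^ 2 * s) * truncConv ν a k s) :=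
    (continuous_exp.comp (continuous_const.mul continuous_id)).mul (continuous_truncConv k)
  have hE : HasDerivAt (fun s => exp (-(ν * (k : ℝ) ^ 2 * s)))
      (exp (-(ν * (k : ℝ) ^ 2 * t)) * (-(ν * (k : ℝ) ^ 2))) t := by
    have := ((hasDerivAt_id t).const_mul (ν * (k : ℝ) ^ 2)).neg.exp
    simpa using this
  have hG : HasDerivAt (fun s => a k + 1 / 2 * ∫ u in (0 : ℝ)..s, exp (ν * (k : ℝ) ^ 2 * u) * truncConv ν a k u)
      (1 / 2 * (exp (ν * (k : ℝ) ^ 2 * t) * truncConv ν a k t)) t := by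
    have := ((hF.integral_hasStrictDerivAt 0 t).hasDerivAt.const_mul (1 / 2 : ℝ)).const_add (a k)
    simpa using this
  have hsol := cascadeSolution_eq (ν := ν) (a := a) k t
  have key : HasDerivAt
      (fun s => exp (-(ν * (k : ℝ) ^ 2 * s)) *
        (a k + 1 / 2 * ∫ u in (0 : ℝ)..s, exp (ν * (k : ℝ) ^ 2 * u) * truncConv ν a k u))
      ((1 / 2) * (∑ p ∈ antidiagonal k, cascadeSolution ν a p.1 t * cascadeSolution ν a p.2 t)
        - ν * (k : ℝ) ^ 2 * cascadeSolution ν a k t) t := by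
    refine (hE.mul hG).congr_deriv ?_
    rw [truncConv_eq h0 k t]
    set S : ℝ := ∑ p ∈ antidiagonal k, cascadeSolution ν a p.1 t * cascadeSolution ν a p.2 t with hS
    set X : ℝ := a k + 1 / 2 * ∫ u in (0 : ℝ)..t, exp (ν * (k : ℝ) ^ 2 * u) * truncConv ν a k u with hX
    have hexp : exp (-(ν * (k : ℝ) ^ 2 * t)) * exp (ν * (k : ℝ) ^ 2 * t) = 1 := by
      rw [← exp_add]; simp
    have h2 : exp (-(ν * (k : ℝ) ^ 2 * t)) * (1 / 2 * (exp (ν * (k : ℝ) ^ 2 * t) * S)) = 1 / 2 * S := by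
      calc exp (-(ν * (k : ℝ) ^ 2 * t)) * (1 / 2 * (exp (ν * (k : ℝ) ^ 2 * t) * S))
          = (exp (-(ν * (k : ℝ) ^ 2 * t)) * exp (ν * (k : ℝ) ^ 2 * t)) * (1 / 2 * S) := by ring
        _ = 1 / 2 * S := by rw [hexp, one_mul]
    rw [h2, hsol]
    ring
  exact key.congr_of_eventuallyEq (Filter.Eventually.of_forall fun s => cascadeSolution_eq k s)

/-- Every mode is differentiable on `ℝ` (indeed `C¹`; needs `a 0 = 0`). -/
theorem differentiable_cascadeSolution (h0 : a 0 = 0) (k : ℕ) : Differentiable ℝ (cascadeSolution ν a k) :=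
  fun t => (hasDerivAt_cascadeSolution h0 k t).differentiableAt

/-! ### Existence: nonnegative data, sine data -/

/-- **The explicit solution is a nonnegative-datum cascade** for `a 0 = 0`, `a k ≥ 0`. [new here — MODEL] -/
theorem isNonnegCascade_cascadeSolution (h0 : a 0 = 0) (ha : ∀ k, 0 ≤ a k) : IsNonnegCascade ν (cascadeSolution ν a) where
  zero := cascadeSolution_mode_zero h0
  cont k := (continuous_cascadeSolution k).continuousOn
  ode k t _ := hasDerivAt_cascadeSolution h0 k t
  init_nonneg k := by rw [cascadeSolution_init]; exact ha k

/-- **GLOBAL EXISTENCE FOR EVERY NONNEGATIVE DATUM (no size condition).** For every `ν` and every datum `a` with `a 0 = 0`,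
`a k ≥ 0`, there is a nonnegative cascade on `[0, ∞)` with `c_k(0) = a_k` for all `k`. [new here — MODEL] -/
theorem exists_isNonnegCascade (ν : ℝ) (a : ℕ → ℝ) (h0 : a 0 = 0) (ha : ∀ k, 0 ≤ a k) :
    ∃ e : ℕ → ℝ → ℝ, IsNonnegCascade ν e ∧ ∀ k, e k 0 = a k :=
  ⟨cascadeSolution ν a, isNonnegCascade_cascadeSolution h0 ha, cascadeSolution_init⟩

/-- The sine datum `ω₀ = −c sin x`: `c_1(0) = c`, all other modes `0`. [new here — MODEL] -/
def sineDatum (c : ℝ) : ℕ → ℝ := fun k => if k = 1 then c else 0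

/-- The sine datum has no mode `0`. -/
@[simp] theorem sineDatum_zero (c : ℝ) : sineDatum c 0 = 0 := by simp [sineDatum]

/-- The sine datum has `c_1(0) = c`. -/
@[simp] theorem sineDatum_one (c : ℝ) : sineDatum c 1 = c := by simp [sineDatum]

/-- The sine datum has no mode `k ≥ 2`. -/
theorem sineDatum_of_two_le (c : ℝ) {k : ℕ} (hk : 2 ≤ k) : sineDatum c k = 0 := by
  have : k ≠ 1 := by omega
  simp [sineDatum, this]

/-- **The explicit solution from the sine datum is a sine-datum cascade** (every `ν`, every `c`). [new here — MODEL] -/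
theorem isSineCascade_cascadeSolution (ν c : ℝ) : IsSineCascade ν c (cascadeSolution ν (sineDatum c)) where
  zero := cascadeSolution_mode_zero (sineDatum_zero c)
  cont k := (continuous_cascadeSolution k).continuousOn
  ode k t _ := hasDerivAt_cascadeSolution (sineDatum_zero c) k t
  one_init := by rw [cascadeSolution_init, sineDatum_one]
  init_zero k hk := by rw [cascadeSolution_init, sineDatum_of_two_le c hk]

/-- **GLOBAL EXISTENCE FOR THE SINE DATUM** (every `ν`, every `c`). [new here — MODEL] -/
theorem exists_isSineCascade (ν c : ℝ) : ∃ e : ℕ → ℝ → ℝ, IsSineCascade ν c e :=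
  ⟨cascadeSolution ν (sineDatum c), isSineCascade_cascadeSolution ν c⟩

/-! ### Uniqueness -/

/-- **Uniqueness of cascades from the datum (sign-free).** Two coefficient families with `c_0 ≡ 0`, continuous on `[0, ∞)`,
solving the cascade for `t > 0`, with equal data, agree on `[0, ∞)`: by strong induction the convolutions driving mode `k`
agree, so `e^{νk²t}(c_k − c′_k)` has zero derivative on `(0, ∞)`, is continuous on `[0, ∞)` and vanishes at `0`.
[new here — MODEL] -/
theorem eq_of_datum_eq {ν : ℝ} {e₁ e₂ : ℕ → ℝ → ℝ}
    (hz₁ : ∀ t, e₁ 0 t = 0) (hz₂ : ∀ t, e₂ 0 t = 0)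
    (hc₁ : ∀ k, ContinuousOn (e₁ k) (Ici 0)) (hc₂ : ∀ k, ContinuousOn (e₂ k) (Ici 0))
    (ho₁ : ∀ k : ℕ, ∀ t : ℝ, 0 < t →
      HasDerivAt (e₁ k) ((1 / 2) * (∑ p ∈ antidiagonal k, e₁ p.1 t * e₁ p.2 t) - ν * (k : ℝ) ^ 2 * e₁ k t) t)
    (ho₂ : ∀ k : ℕ, ∀ t : ℝ, 0 < t →
      HasDerivAt (e₂ k) ((1 / 2) * (∑ p ∈ antidiagonal k, e₂ p.1 t * e₂ p.2 t) - ν * (k : ℝ) ^ 2 * e₂ k t) t)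
    (hinit : ∀ k, e₁ k 0 = e₂ k 0) : ∀ k : ℕ, ∀ t : ℝ, 0 ≤ t → e₁ k t = e₂ k t := by
  intro k
  induction k using Nat.strong_induction_on with
  | _ k ih =>
    intro t ht
    -- the convolutions agree for `s > 0`
    have hconv : ∀ s : ℝ, 0 < s →
        ∑ p ∈ antidiagonal k, e₁ p.1 s * e₁ p.2 s = ∑ p ∈ antidiagonal k, e₂ p.1 s * e₂ p.2 s := by
      intro s hs
      refine sum_congr rfl fun p hp => ?_
      have hsum : p.1 + p.2 = k := mem_antidiagonal.mp hp
      rcases Nat.eq_zero_or_pos p.1 with h1 | h1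
      · rw [h1, hz₁, hz₂, zero_mul, zero_mul]
      rcases Nat.eq_zero_or_pos p.2 with h2 | h2
      · rw [h2, hz₁, hz₂, mul_zero, mul_zero]
      rw [ih p.1 (by omega) s hs.le, ih p.2 (by omega) s hs.le]
    -- `w(s) = e^{νk²s}(e₁ k s − e₂ k s)` is constant on `[0, ∞)`
    set w : ℝ → ℝ := fun s => exp (ν * (k : ℝ) ^ 2 * s) * (e₁ k s - e₂ k s) with hw
    have hwcont : ContinuousOn w (Ici 0) :=
      ((continuous_exp.comp (continuous_const.mul continuous_id)).continuousOn).mul ((hc₁ k).sub (hc₂ k))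
    have hwder : ∀ s : ℝ, 0 < s → HasDerivAt w 0 s := by
      intro s hs
      have h1 : HasDerivAt (fun s => exp (ν * (k : ℝ) ^ 2 * s)) (exp (ν * (k : ℝ) ^ 2 * s) * (ν * (k : ℝ) ^ 2)) s := by
        have := ((hasDerivAt_id s).const_mul (ν * (k : ℝ) ^ 2)).exp
        simpa using this
      have h2 : HasDerivAt (fun s => e₁ k s - e₂ k s)
          ((1 / 2) * (∑ p ∈ antidiagonal k, e₁ p.1 s * e₁ p.2 s) - ν * (k : ℝ) ^ 2 * e₁ k s
            - ((1 / 2) * (∑ p ∈ antidiagonal k, e₂ p.1 s * e₂ p.2 s) - ν * (k : ℝ) ^ 2 * e₂ k s)) s :=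
        (ho₁ k s hs).sub (ho₂ k s hs)
      refine (h1.mul h2).congr_deriv ?_
      rw [hconv s hs]
      ring
    have hmono : MonotoneOn w (Ici 0) :=
      monotoneOn_of_hasDerivWithinAt_nonneg (f' := fun _ => 0) (convex_Ici 0) hwcont
        (fun s hs => by rw [interior_Ici] at hs; exact (hwder s hs).hasDerivWithinAt) (fun s _ => le_rfl)
    have hanti : AntitoneOn w (Ici 0) :=
      antitoneOn_of_hasDerivWithinAt_nonpos (f' := fun _ => 0) (convex_Ici 0) hwcont
        (fun s hs => by rw [interior_Ici] at hs; exact (hwder s hs).hasDerivWithinAt) (fun s _ => le_rfl)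
    have hw0 : w 0 = 0 := by simp [hw, hinit k]
    have hwt : w t = 0 := le_antisymm (by simpa [hw0] using hanti self_mem_Ici ht ht)
      (by simpa [hw0] using hmono self_mem_Ici ht ht)
    have hexp : exp (ν * (k : ℝ) ^ 2 * t) ≠ 0 := (exp_pos _).ne'
    have : e₁ k t - e₂ k t = 0 := by
      have h := hwt
      simp only [hw, mul_eq_zero] at h
      rcases h with h | h
      · exact absurd h hexp
      · exact h
    linarith

/-- **Uniqueness among nonnegative cascades**: equal data ⇒ equal on `[0, ∞)`. [new here — MODEL] -/
theorem IsNonnegCascade.eq_of_datum_eq {e₁ e₂ : ℕ → ℝ → ℝ} (h₁ : IsNonnegCascade ν e₁) (h₂ : IsNonnegCascade ν e₂)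
    (hinit : ∀ k, e₁ k 0 = e₂ k 0) : ∀ k : ℕ, ∀ t : ℝ, 0 ≤ t → e₁ k t = e₂ k t :=
  SheetNSLineTorusCascade.eq_of_datum_eq h₁.zero h₂.zero h₁.cont h₂.cont h₁.ode h₂.ode hinit

/-- **Uniqueness of the sine-datum cascade**: any two sine cascades with the same `ν`, `c` agree on `[0, ∞)`.
[new here — MODEL] -/
theorem IsSineCascade.unique {e₁ e₂ : ℕ → ℝ → ℝ} (h₁ : IsSineCascade ν c e₁) (h₂ : IsSineCascade ν c e₂) :
    ∀ k : ℕ, ∀ t : ℝ, 0 ≤ t → e₁ k t = e₂ k t := by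
  refine SheetNSLineTorusCascade.eq_of_datum_eq h₁.zero h₂.zero h₁.cont h₂.cont h₁.ode h₂.ode fun k => ?_
  rcases Nat.lt_or_ge k 2 with hk | hk
  · interval_cases k
    · rw [h₁.zero, h₂.zero]
    · rw [h₁.one_init, h₂.one_init]
  · rw [h₁.init_zero k hk, h₂.init_zero k hk]

/-- **Every nonnegative cascade IS the explicit solution from its own datum** (on `[0, ∞)`). [new here — MODEL] -/
theorem IsNonnegCascade.eq_cascadeSolution {e : ℕ → ℝ → ℝ} (he : IsNonnegCascade ν e) :
    ∀ k : ℕ, ∀ t : ℝ, 0 ≤ t → e k t = cascadeSolution ν (fun k => e k 0) k t :=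
  he.eq_of_datum_eq (isNonnegCascade_cascadeSolution (a := fun k => e k 0) (he.zero 0) he.init_nonneg)
    fun k => (cascadeSolution_init (ν := ν) (a := fun k => e k 0) k).symm

/-- **Every sine cascade IS the explicit solution from the sine datum** (on `[0, ∞)`). [new here — MODEL] -/
theorem IsSineCascade.eq_cascadeSolution {e : ℕ → ℝ → ℝ} (he : IsSineCascade ν c e) :
    ∀ k : ℕ, ∀ t : ℝ, 0 ≤ t → e k t = cascadeSolution ν (sineDatum c) k t :=
  he.unique (isSineCascade_cascadeSolution ν c)

/-! ### The census packaging: the family's conditional theorems, unconditionally -/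

/-- **GLOBAL `B₀` BOUND BELOW THE WIENER THRESHOLD, unconditionally.** For `ν > 0` and a nonnegative datum with `a 0 = 0`,
`a 1 > 0` and `Σ_{k≤K} a_k ≤ W < 2ν` for every `K` (`‖ω₀‖_{B₀} ≤ W`): the cascade from `a` exists on `[0, ∞)`, is unique, and
obeys `Σ_{k≤K} c_k(t) ≤ (2νW/(2ν − W))·e^{−νt}` for all `K`, `t ≥ 0` (`IsNonnegCascade.partialSum_le_of_wiener` applied to the
constructed object). [new here — MODEL] -/
theorem exists_global_of_wiener (hν : 0 < ν) (h0 : a 0 = 0) (ha : ∀ k, 0 ≤ a k) (h1 : 0 < a 1)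
    {W : ℝ} (hW : W < 2 * ν) (hdata : ∀ K, ∑ k ∈ range (K + 1), a k ≤ W) :
    ∃ e : ℕ → ℝ → ℝ, IsNonnegCascade ν e ∧ (∀ k, e k 0 = a k) ∧
      ∀ (K : ℕ) (t : ℝ), 0 ≤ t → ∑ k ∈ range (K + 1), e k t ≤ 2 * ν * W / (2 * ν - W) * exp (-(ν * t)) := by
  have he := isNonnegCascade_cascadeSolution (ν := ν) h0 ha
  refine ⟨cascadeSolution ν a, he, cascadeSolution_init, fun K t ht => ?_⟩
  have h1' : 0 < cascadeSolution ν a 1 0 := by rw [cascadeSolution_init]; exact h1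
  have hdata' : ∀ K, ∑ k ∈ range (K + 1), cascadeSolution ν a k 0 ≤ W := by
    intro K
    simpa only [cascadeSolution_init] using hdata K
  exact he.partialSum_le_of_wiener hν h1' hW hdata' K t ht

/-- **GLOBAL STATIONARY-POLE BOUND FOR SINE DATA `c < 12ν`, unconditionally**: the sine cascade exists on `[0, ∞)` and obeys
`Σ_{k≤K} c_k(t) ≤ 144ν²c/(12ν − c)²` for all `K`, `t ≥ 0` (`partialSum_le_stationaryPole` on the constructed object).
[new here — MODEL] -/
theorem exists_global_sine_of_lt_twelve (hν : 0 < ν) (hc : 0 ≤ c) (hsmall : c < 12 * ν) :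
    ∃ e : ℕ → ℝ → ℝ, IsSineCascade ν c e ∧
      ∀ (K : ℕ) (t : ℝ), 0 ≤ t → ∑ k ∈ range (K + 1), e k t ≤ 144 * ν ^ 2 * c / (12 * ν - c) ^ 2 :=
  ⟨cascadeSolution ν (sineDatum c), isSineCascade_cascadeSolution ν c,
    fun K t ht => partialSum_le_stationaryPole (isSineCascade_cascadeSolution ν c) hν hc hsmall K t ht⟩

/-- **BLOW-UP SIDE FOR SINE DATA `c ≥ 48ν`, unconditionally**: the (unique) sine cascade has unbounded coefficients at
`t = log 2/ν` (`unbounded_of_le` on the constructed object). [new here — MODEL] -/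
theorem exists_sine_unbounded_of_le (hν : 0 < ν) (hc : 48 * ν ≤ c) :
    ∃ e : ℕ → ℝ → ℝ, IsSineCascade ν c e ∧ ∀ M : ℝ, ∃ k : ℕ, M < e k (log 2 / ν) :=
  ⟨cascadeSolution ν (sineDatum c), isSineCascade_cascadeSolution ν c,
    unbounded_of_le (isSineCascade_cascadeSolution ν c) hν hc⟩

/-- The same on THE explicit object: for `48ν ≤ c` the coefficients `cascadeSolution ν (sineDatum c) k (log 2/ν)` are
unbounded in `k`. [new here — MODEL] -/
theorem cascadeSolution_sine_unbounded_of_le (hν : 0 < ν) (hc : 48 * ν ≤ c) (M : ℝ) :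
    ∃ k : ℕ, M < cascadeSolution ν (sineDatum c) k (log 2 / ν) :=
  unbounded_of_le (isSineCascade_cascadeSolution ν c) hν hc M

end SheetNSLineTorusCascade
end Summit.NavierStokesRegularity.OSWSelfSimilar

end
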